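import Summits.AtomisticToContinuum.Crystallization.Theorems.OverbindingBudgetMatchCompactness

/-!
# OverbindingBudget — the hull engine `minimalRecurrent` over `Match` (port of `CleanHull.stub_minimalRecurrent`)
(decomp-a2c lens 4, generation 21; helper `--supports stmt-AtomisticToContinuum-31280`; part of the node «RecurrentSeal», whose
statement and reading are in `…Theorems.OverbindingBudgetRecurrentSeal`)

`minimalRecurrent`: a non-empty family `𝒞` of rooted (`0 ∈ Z`), `δ`-separated (`δ > 0`) point sets of `ℝ³` that is closed under re-rooting
(`Z ∈ 𝒞, z ∈ Z ⟹ Z − z ∈ 𝒞`) and under local limits (`Match`-convergence on every ball about `0`) contains a UNIFORMLY RECURRENT member: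
`∀ R ε, 0 < ε → ∃ G, ∀ w ∈ Z, ∃ g ∈ Z, dist g w ≤ G ∧ Match ε R 0 (Z − g) Z` (Birkhoff: a minimal closed shift-invariant subfamily exists by a
countable descent over open avoidance conditions + compactness, and its members are almost periodic).

PORT NOTE.  VERBATIM port of the tree's `…GappedShellCensusCleanLimitsHaveWindowsMinimalRecurrent` §S2 (`CleanHull.stub_minimalRecurrent`,
over `MuGroundStateConfiguration.lean` / `BallMatch`) to the `MuGSC.lean` world (`Match ε R 0`), forced by the `UniformlyDiscrete` name clash
explained in `…OverbindingBudgetMatchCompactness`; auxiliary lemmas kept `private` (`mr*`).  Serves ALSO the open item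
stmt-AtomisticToContinuum-26048 (`RecurrentMuStableLimit`, MuGSC world), whose last step is exactly this kernel. [folklore]
-/

noncomputable section

namespace Summit.AtomisticToContinuum.Crystallization.Theorems.OverbindingBudgetHullEngine

open Filter Metric Set Topology
open Literature.MathematicalPhysics.StatisticalMechanics
open Summit.AtomisticToContinuum.Crystallization.Theorems.OverbindingBudgetMatchCompactness

variable {d : ℕ}

/-- Composition of two-way matchings about the same centre (precisions add, radii shrink). [folklore] -/
private theorem mrComp {α : Type*} [PseudoMetricSpace α] {ε₁ ε₂ R R₁ R₂ : ℝ} {c : α}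
    {A B C : Set α} (h₁ : Match ε₁ R₁ c A B) (h₂ : Match ε₂ R₂ c B C)
    (hε₁ : 0 ≤ ε₁) (hε₂ : 0 ≤ ε₂) (hR₁ : R + ε₂ ≤ R₁) (hR₂ : R + ε₁ ≤ R₂) :
    Match (ε₁ + ε₂) R c A C := by
  refine ⟨fun s hs hsc => ?_, fun a ha hac => ?_⟩
  · obtain ⟨b, hb, hbs⟩ := h₂.1 s hs (by linarith)
    obtain ⟨a, ha, hab⟩ := h₁.1 b hb (by linarith [dist_triangle b s c])
    exact ⟨a, ha, (dist_triangle a b s).trans (add_le_add hab hbs)⟩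
  · obtain ⟨b, hb, hab⟩ := h₁.2 a ha (by linarith)
    obtain ⟨s, hs, hbs⟩ := h₂.2 b hb (by linarith [dist_triangle b a c, dist_comm a b])
    exact ⟨s, hs, (dist_triangle a b s).trans (add_le_add hab hbs)⟩

/-- Re-rooting transfer: if `A, B` are `η`-matched on `B(0, R')` and `b ∈ B` lies in that ball,
then some `a ∈ A` is within `η` of `b`, and the re-rooted sets `A - a`, `B - b` are `2η`-matched
on `B(0, R)` as soon as `R + ‖b‖ + η ≤ R'`. [folklore] -/
private theorem mrTransfer {E : Type*} [SeminormedAddCommGroup E] {η R R' : ℝ} {A B : Set E}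
    (h : Match η R' 0 A B) {b : E} (hb : b ∈ B) (hbR : ‖b‖ ≤ R') (hR : R + ‖b‖ + η ≤ R')
    (hη : 0 ≤ η) :
    ∃ a ∈ A, dist a b ≤ η ∧
      Match (2 * η) R 0 ((fun p => p - a) '' A) ((fun p => p - b) '' B) := by
  obtain ⟨a, ha, hab⟩ := h.1 b hb (by rwa [dist_zero_right])
  refine ⟨a, ha, hab, ?_, ?_⟩
  · rintro _ ⟨b', hb', rfl⟩ hs
    rw [dist_zero_right] at hs
    have hb'R : dist b' 0 ≤ R' := by
      rw [dist_zero_right]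
      linarith [norm_sub_norm_le b' b]
    obtain ⟨a', ha', hab'⟩ := h.1 b' hb' hb'R
    exact ⟨a' - a, ⟨a', ha', rfl⟩, by linarith [dist_sub_sub_le a' a b' b]⟩
  · rintro _ ⟨a', ha', rfl⟩ hs
    rw [dist_zero_right] at hs
    have ha'R : dist a' 0 ≤ R' := by
      rw [dist_zero_right]
      linarith [norm_sub_norm_le a' a, norm_sub_norm_le a b, dist_eq_norm a b]
    obtain ⟨b', hb', hab'⟩ := h.2 a' ha' ha'R
    exact ⟨b' - b, ⟨b', hb', rfl⟩, by linarith [dist_sub_sub_le a' a b' b]⟩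

/-- Re-rootings of re-rootings are re-rootings: `(Z - z) - w = Z - (z + w)`. [folklore] -/
private theorem mrImage_sub_sub {E : Type*} [AddCommGroup E] (Z : Set E) (z w : E) :
    (fun p => p - w) '' ((fun p => p - z) '' Z) = (fun p => p - (z + w)) '' Z := by
  rw [Set.image_image]
  simp_rw [sub_sub]

/-- A point of the re-rooted set `Z - z` translates back into `Z`. [folklore] -/
private theorem mrMem_of_mem_image {E : Type*} [AddCommGroup E] {Z : Set E} {z w : E}
    (h : w ∈ (fun p => p - z) '' Z) : z + w ∈ Z := by
  obtain ⟨p, hp, rfl⟩ := h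
  simpa using hp

/-! ## §B (ii)  Open avoidance conditions -/

/-- Realisation is open in the local matching sense, with control of the root: if `Zs k → Z`
locally and `Z - z` (`z ∈ Z`) is `ε'`-matched to `P` on `B(0, R₁)` with `ε' < ε₀`, `R < R₁`,
then eventually `Zs k` realises `(R, ε₀, P)` (some re-rooting `Zs k - z'`, `z' ∈ Zs k`, is
`ε''`-matched to `P` on `B(0, R₂)` with `ε'' < ε₀`, `R < R₂`) at a root `z'` of norm
`≤ ‖z‖ + 1`. [folklore] -/
private theorem mrReal_eventually {E : Type*} [SeminormedAddCommGroup E] {Zs : ℕ → Set E}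
    {Z : Set E} (hconv : ∀ R ε : ℝ, 0 < ε → ∀ᶠ k in atTop, Match ε R 0 (Zs k) Z)
    {z : E} (hz : z ∈ Z) {ε' ε₀ R R₁ : ℝ} (hε'0 : 0 ≤ ε') (hε' : ε' < ε₀) (hR : 0 ≤ R)
    (hR₁ : R < R₁) {P : Set E} (hbm : Match ε' R₁ 0 ((fun p => p - z) '' Z) P) :
    ∀ᶠ k in atTop, ∃ z' ∈ Zs k, ‖z'‖ ≤ ‖z‖ + 1 ∧ ∃ ε'' R₂ : ℝ, 0 ≤ ε'' ∧ ε'' < ε₀ ∧ R < R₂ ∧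
      Match ε'' R₂ 0 ((fun p => p - z') '' Zs k) P := by
  set η : ℝ := min ((ε₀ - ε') / 4) (min ((R₁ - R) / 4) 1) with hη
  have hη0 : 0 < η := lt_min (by linarith) (lt_min (by linarith) one_pos)
  have hη1 : η ≤ (ε₀ - ε') / 4 := min_le_left _ _
  have hη2 : η ≤ (R₁ - R) / 4 := (min_le_right _ _).trans (min_le_left _ _)
  have hη3 : η ≤ 1 := (min_le_right _ _).trans (min_le_right _ _)
  filter_upwards [hconv (R₁ + ε₀ + ‖z‖ + η) η hη0] with k hk
  obtain ⟨z', hz', hz'z, hbm'⟩ :=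
    mrTransfer (R := R₁ + ε₀) hk hz (by linarith [norm_nonneg z]) (by linarith) hη0.le
  refine ⟨z', hz', ?_, 2 * η + ε', R₁ - 2 * η, by linarith, by linarith, by linarith, ?_⟩
  · have h1 := norm_sub_norm_le z' z
    rw [← dist_eq_norm] at h1
    linarith
  · exact mrComp hbm' hbm (by linarith) hε'0 (by linarith) (by linarith)

/-! ## §B (iii)  Descending families -/

/-- One stage of the descent.  Call a subfamily GOOD if it is a non-empty subfamily of `𝒞`
closed under re-rooting and under local limits (to `δ`-separated sets containing `0`), and say
that `Z` REALISES the condition `(R, ε₀, P)` if some re-rooting `Z - z` (`z ∈ Z`) is two-way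
matched to the pattern `P` with strict slack (tolerance `ε' < ε₀` on a ball of radius
`R₁ > R`).  For every good `𝒟` there is a good `𝒟' ⊆ 𝒟` with the KEY property: if one member
of `𝒟'` realises the condition then all do.  (`𝒟'` is the subfamily of avoiders if that is
non-empty, else `𝒟`; avoidance is invariant under re-rooting and closed under local limits by
`mrReal_eventually`.) [folklore] -/
private theorem mrStage {E : Type*} [SeminormedAddCommGroup E] {δ : ℝ} {𝒞 : Set (Set E)}
    (𝒟 : Set (Set E)) {R : ℝ} (hR : 0 ≤ R) (ε₀ : ℝ) (P : Set E) :
    ∃ 𝒟' : Set (Set E),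
      (𝒟 ⊆ 𝒞 ∧ 𝒟.Nonempty ∧ (∀ Z ∈ 𝒟, ∀ z ∈ Z, (fun p => p - z) '' Z ∈ 𝒟) ∧
        ∀ Zs : ℕ → Set E, (∀ k, Zs k ∈ 𝒟) → ∀ Z : Set E, (0 : E) ∈ Z →
          (∀ p ∈ Z, ∀ q ∈ Z, p ≠ q → δ ≤ dist p q) →
          (∀ R ε : ℝ, 0 < ε → ∀ᶠ k in atTop, Match ε R 0 (Zs k) Z) → Z ∈ 𝒟) →
      𝒟' ⊆ 𝒟 ∧
      (𝒟' ⊆ 𝒞 ∧ 𝒟'.Nonempty ∧ (∀ Z ∈ 𝒟', ∀ z ∈ Z, (fun p => p - z) '' Z ∈ 𝒟') ∧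
        ∀ Zs : ℕ → Set E, (∀ k, Zs k ∈ 𝒟') → ∀ Z : Set E, (0 : E) ∈ Z →
          (∀ p ∈ Z, ∀ q ∈ Z, p ≠ q → δ ≤ dist p q) →
          (∀ R ε : ℝ, 0 < ε → ∀ᶠ k in atTop, Match ε R 0 (Zs k) Z) → Z ∈ 𝒟') ∧
      ∀ Z₁ ∈ 𝒟', (∃ z ∈ Z₁, ∃ ε' R₁ : ℝ, 0 ≤ ε' ∧ ε' < ε₀ ∧ R < R₁ ∧
          Match ε' R₁ 0 ((fun p => p - z) '' Z₁) P) →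
        ∀ W ∈ 𝒟', ∃ z ∈ W, ∃ ε' R₁ : ℝ, 0 ≤ ε' ∧ ε' < ε₀ ∧ R < R₁ ∧
          Match ε' R₁ 0 ((fun p => p - z) '' W) P := by
  classical
  by_cases hex : ∃ Z ∈ 𝒟, ¬ ∃ z ∈ Z, ∃ ε' R₁ : ℝ, 0 ≤ ε' ∧ ε' < ε₀ ∧ R < R₁ ∧
      Match ε' R₁ 0 ((fun p => p - z) '' Z) P
  · obtain ⟨Z₀, hZ₀, hZ₀a⟩ := hex
    refine ⟨{Z ∈ 𝒟 | ¬ ∃ z ∈ Z, ∃ ε' R₁ : ℝ, 0 ≤ ε' ∧ ε' < ε₀ ∧ R < R₁ ∧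
      Match ε' R₁ 0 ((fun p => p - z) '' Z) P}, ?_⟩
    rintro ⟨hsub, -, hroot, hlim⟩
    refine ⟨fun Z hZ => hZ.1, ⟨fun Z hZ => hsub hZ.1, ⟨Z₀, hZ₀, hZ₀a⟩,
      fun Z hZ z hz => ⟨hroot Z hZ.1 z hz, ?_⟩,
      fun Zs hZs Z h0 hs hc => ⟨hlim Zs (fun k => (hZs k).1) Z h0 hs hc, ?_⟩⟩,
      fun Z₁ hZ₁ hR₁ W _ => absurd hR₁ hZ₁.2⟩
    · rintro ⟨w, hw, ε', R₁, hε'0, hε', hR₁, hbm⟩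
      refine hZ.2 ⟨z + w, mrMem_of_mem_image hw, ε', R₁, hε'0, hε', hR₁, ?_⟩
      rwa [mrImage_sub_sub] at hbm
    · rintro ⟨z, hz, ε', R₁, hε'0, hε', hR₁, hbm⟩
      obtain ⟨k, z', hz', -, hreal⟩ := (mrReal_eventually hc hz hε'0 hε' hR hR₁ hbm).exists
      exact (hZs k).2 ⟨z', hz', hreal⟩
  · push Not at hex
    exact ⟨𝒟, fun h => ⟨subset_rfl, h, fun Z₁ _ _ W hW => hex W hW⟩⟩

/-- The descent along an enumeration `cond` of conditions (radii `≥ 0`): a decreasing sequence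
of good subfamilies `fam n` of `𝒞` (good: subfamily, non-empty, re-rooting closed, limit
closed), stage `n + 1` having the KEY property for condition `n` (`fam 0 = 𝒞`, `fam (n + 1)`
from `mrStage`). [folklore] -/
private theorem mrDescend {E : Type*} [SeminormedAddCommGroup E] {δ : ℝ} {𝒞 : Set (Set E)}
    (hne : 𝒞.Nonempty) (hroot : ∀ Z ∈ 𝒞, ∀ z ∈ Z, (fun p => p - z) '' Z ∈ 𝒞)
    (hclosed : ∀ Zs : ℕ → Set E, (∀ k, Zs k ∈ 𝒞) → ∀ Z : Set E, (0 : E) ∈ Z →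
      (∀ p ∈ Z, ∀ q ∈ Z, p ≠ q → δ ≤ dist p q) →
      (∀ R ε : ℝ, 0 < ε → ∀ᶠ k in atTop, Match ε R 0 (Zs k) Z) → Z ∈ 𝒞)
    (cond : ℕ → ℝ × ℝ × Set E) (hcond : ∀ n, 0 ≤ (cond n).1) :
    ∃ fam : ℕ → Set (Set E), (∀ n, fam n ⊆ 𝒞) ∧ (∀ n, (fam n).Nonempty) ∧
      (∀ n, ∀ Z ∈ fam n, ∀ z ∈ Z, (fun p => p - z) '' Z ∈ fam n) ∧
      (∀ n, ∀ Zs : ℕ → Set E, (∀ k, Zs k ∈ fam n) → ∀ Z : Set E, (0 : E) ∈ Z →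
        (∀ p ∈ Z, ∀ q ∈ Z, p ≠ q → δ ≤ dist p q) →
        (∀ R ε : ℝ, 0 < ε → ∀ᶠ k in atTop, Match ε R 0 (Zs k) Z) → Z ∈ fam n) ∧
      Antitone fam ∧
      ∀ n, ∀ Z₁ ∈ fam (n + 1), (∃ z ∈ Z₁, ∃ ε' R₁ : ℝ, 0 ≤ ε' ∧ ε' < (cond n).2.1 ∧
          (cond n).1 < R₁ ∧ Match ε' R₁ 0 ((fun p => p - z) '' Z₁) (cond n).2.2) →
        ∀ W ∈ fam (n + 1), ∃ z ∈ W, ∃ ε' R₁ : ℝ, 0 ≤ ε' ∧ ε' < (cond n).2.1 ∧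
          (cond n).1 < R₁ ∧ Match ε' R₁ 0 ((fun p => p - z) '' W) (cond n).2.2 := by
  choose next hnext using fun (𝒟 : Set (Set E)) (n : ℕ) =>
    mrStage (δ := δ) (𝒞 := 𝒞) 𝒟 (hcond n) (cond n).2.1 (cond n).2.2
  obtain ⟨fam, hfam0, hfamS⟩ : ∃ fam : ℕ → Set (Set E),
      fam 0 = 𝒞 ∧ ∀ n, fam (n + 1) = next (fam n) n :=
    ⟨fun n => Nat.rec (motive := fun _ => Set (Set E)) 𝒞 (fun k 𝒟 => next 𝒟 k) n, rfl,
      fun _ => rfl⟩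
  have hG : ∀ n, fam n ⊆ 𝒞 ∧ (fam n).Nonempty ∧
      (∀ Z ∈ fam n, ∀ z ∈ Z, (fun p => p - z) '' Z ∈ fam n) ∧
      ∀ Zs : ℕ → Set E, (∀ k, Zs k ∈ fam n) → ∀ Z : Set E, (0 : E) ∈ Z →
        (∀ p ∈ Z, ∀ q ∈ Z, p ≠ q → δ ≤ dist p q) →
        (∀ R ε : ℝ, 0 < ε → ∀ᶠ k in atTop, Match ε R 0 (Zs k) Z) → Z ∈ fam n := by
    intro n
    induction n with
    | zero =>
      rw [hfam0]
      exact ⟨subset_rfl, hne, hroot, hclosed⟩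
    | succ n ih =>
      rw [hfamS]
      exact (hnext _ _ ih).2.1
  refine ⟨fam, fun n => (hG n).1, fun n => (hG n).2.1, fun n => (hG n).2.2.1,
    fun n => (hG n).2.2.2, antitone_nat_of_succ_le fun n => ?_, fun n => ?_⟩
  · rw [hfamS]
    exact (hnext _ _ (hG n)).1
  · rw [hfamS]
    exact (hnext _ _ (hG n)).2.2

/-! ## §B (iv)  Limits in `ℝᵈ`: `0` survives, compactness inside the family, finite patterns -/

variable {d : ℕ}

/-- If all `Zs k` contain `0` and converge locally to a `δ`-separated `Z` (`δ > 0`), then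
`0 ∈ Z`: `Z` has points of arbitrarily small norm, and only finitely many in the unit ball.
[folklore] -/
private theorem mrZeroMem {δ : ℝ} (hδ : 0 < δ) {Zs : ℕ → Set (EuclideanSpace ℝ (Fin d))}
    {Z : Set (EuclideanSpace ℝ (Fin d))} (h0 : ∀ k, (0 : EuclideanSpace ℝ (Fin d)) ∈ Zs k)
    (hsep : ∀ p ∈ Z, ∀ q ∈ Z, p ≠ q → δ ≤ dist p q)
    (hconv : ∀ R ε : ℝ, 0 < ε → ∀ᶠ k in atTop, Match ε R 0 (Zs k) Z) :
    (0 : EuclideanSpace ℝ (Fin d)) ∈ Z := by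
  have hfin : (Z ∩ closedBall (0 : EuclideanSpace ℝ (Fin d)) 1).Finite :=
    UniformlyDiscrete.finite_inter_closedBall (X := Z) ⟨δ, hδ, hsep⟩ 0 1
  have h1 : ∀ᶠ ε in 𝓝[>] (0 : ℝ), ∀ s ∈ Z ∩ closedBall (0 : EuclideanSpace ℝ (Fin d)) 1,
      s ≠ 0 → ε < ‖s‖ := by
    refine hfin.eventually_all.2 fun s _ => ?_
    by_cases hs0 : s = 0
    · exact Eventually.of_forall fun _ h => absurd hs0 h
    · exact ((eventually_lt_nhds (norm_pos_iff.2 hs0)).filter_mono nhdsWithin_le_nhds).mono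
        fun _ h _ => h
  have h2 : ∀ᶠ ε in 𝓝[>] (0 : ℝ), ε < 1 :=
    (eventually_lt_nhds one_pos).filter_mono nhdsWithin_le_nhds
  have h3 : ∀ᶠ ε in 𝓝[>] (0 : ℝ), 0 < ε := eventually_mem_nhdsWithin
  obtain ⟨ε, hε1, hε2, hε3⟩ := (h1.and (h2.and h3)).exists
  obtain ⟨k, hk⟩ := (hconv 0 ε hε3).exists
  obtain ⟨s, hs, hs0⟩ := hk.2 0 (h0 k) (by simp)
  rw [dist_comm, dist_zero_right] at hs0
  by_contra hZ
  have hsne : s ≠ 0 := fun h => hZ (h ▸ hs)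
  have := hε1 s ⟨hs, mem_closedBall_zero_iff.2 (hs0.trans hε2.le)⟩ hsne
  linarith

/-- Sequential compactness inside the family: a sequence in `𝒞` has a subsequence converging
locally to a member of `𝒞` (tree: `exists_subseq_forall_eventually_match`; the limit
contains `0` by `mrZeroMem`, so limit-closedness applies). [folklore] -/
private theorem mrCompact {δ : ℝ} (hδ : 0 < δ) {𝒞 : Set (Set (EuclideanSpace ℝ (Fin d)))}
    (hsep : ∀ Z ∈ 𝒞, ∀ p ∈ Z, ∀ q ∈ Z, p ≠ q → δ ≤ dist p q)
    (h0 : ∀ Z ∈ 𝒞, (0 : EuclideanSpace ℝ (Fin d)) ∈ Z)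
    (hclosed : ∀ Zs : ℕ → Set (EuclideanSpace ℝ (Fin d)), (∀ k, Zs k ∈ 𝒞) →
      ∀ Z : Set (EuclideanSpace ℝ (Fin d)), (0 : EuclideanSpace ℝ (Fin d)) ∈ Z →
      (∀ p ∈ Z, ∀ q ∈ Z, p ≠ q → δ ≤ dist p q) →
      (∀ R ε : ℝ, 0 < ε → ∀ᶠ k in atTop, Match ε R 0 (Zs k) Z) → Z ∈ 𝒞)
    {Zs : ℕ → Set (EuclideanSpace ℝ (Fin d))} (hZs : ∀ k, Zs k ∈ 𝒞) :
    ∃ (φ : ℕ → ℕ) (Z : Set (EuclideanSpace ℝ (Fin d))), StrictMono φ ∧ Z ∈ 𝒞 ∧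
      (0 : EuclideanSpace ℝ (Fin d)) ∈ Z ∧ (∀ p ∈ Z, ∀ q ∈ Z, p ≠ q → δ ≤ dist p q) ∧
      ∀ R ε : ℝ, 0 < ε → ∀ᶠ k in atTop, Match ε R 0 (Zs (φ k)) Z := by
  obtain ⟨φ, Z, hφ, hZsep, hconv⟩ :=
    exists_subseq_forall_eventually_match hδ Zs fun k => hsep _ (hZs k)
  have h0Z : (0 : EuclideanSpace ℝ (Fin d)) ∈ Z :=
    mrZeroMem hδ (fun k => h0 _ (hZs (φ k))) hZsep hconv
  exact ⟨φ, Z, hφ, hclosed _ (fun k => hZs (φ k)) Z h0Z hZsep hconv, h0Z, hZsep, hconv⟩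

/-- Finite patterns from a dense sequence approximate a separated set on every ball: for `u`
dense, `Z` `δ`-separated and `τ > 0` there is `F : Finset ℕ` with `Z` and `u '' F` two-way
`τ`-matched on `B(0, Rp)` (approximate the finitely many points of `Z` in the ball).
[folklore] -/
private theorem mrPattern {u : ℕ → EuclideanSpace ℝ (Fin d)} (hu : DenseRange u) {δ : ℝ}
    (hδ : 0 < δ) {Z : Set (EuclideanSpace ℝ (Fin d))}
    (hsep : ∀ p ∈ Z, ∀ q ∈ Z, p ≠ q → δ ≤ dist p q) {τ : ℝ} (hτ : 0 < τ) (Rp : ℝ) :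
    ∃ F : Finset ℕ, Match τ Rp 0 Z (u '' (F : Set ℕ)) := by
  classical
  have hfin : (Z ∩ closedBall (0 : EuclideanSpace ℝ (Fin d)) Rp).Finite :=
    UniformlyDiscrete.finite_inter_closedBall (X := Z) ⟨δ, hδ, hsep⟩ 0 Rp
  choose i hi using fun q : EuclideanSpace ℝ (Fin d) => hu.exists_dist_lt q hτ
  refine ⟨hfin.toFinset.image i, ?_⟩
  have hP : u '' ((hfin.toFinset.image i : Finset ℕ) : Set ℕ) =
      (fun q => u (i q)) '' (Z ∩ closedBall (0 : EuclideanSpace ℝ (Fin d)) Rp) := by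
    rw [Finset.coe_image, hfin.coe_toFinset, Set.image_image]
  rw [hP]
  refine ⟨?_, fun a ha haR => ?_⟩
  · rintro _ ⟨q, hq, rfl⟩ _
    exact ⟨q, hq.1, (hi q).le⟩
  · exact ⟨u (i a), ⟨a, ⟨ha, mem_closedBall.2 haR⟩, rfl⟩, (hi a).le⟩

/-! ## §C  The hull engine `minimalRecurrent` -/

/-- **Stub S2 (abstract: a rooted, separated, re-rooting- and limit-closed family has a uniformly
recurrent member).** Let `𝒞` be a non-empty family of `δ`-separated subsets of `ℝ³` containing
`0`, closed under re-rooting (`Z ↦ Z - z`, `z ∈ Z`) and under local limits of its sequences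
(limits that contain `0` and are `δ`-separated). Then some `Z ∈ 𝒞` is rooted-uniformly
recurrent: every `(R, ε)`-patch of `Z` about `0` reappears up to `ε` about a point of `Z` within
bounded distance of every point of `Z`. (Sequential compactness:
`exists_subseq_forall_eventually_match`; minimality by a countable family of open avoidance
conditions; Birkhoff's argument.) [folklore] -/
theorem minimalRecurrent (δ : ℝ) (hδ : 0 < δ) (𝒞 : Set (Set (EuclideanSpace ℝ (Fin 3))))
    (hne : 𝒞.Nonempty)
    (hsep : ∀ Z ∈ 𝒞, ∀ p ∈ Z, ∀ q ∈ Z, p ≠ q → δ ≤ dist p q)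
    (h0 : ∀ Z ∈ 𝒞, (0 : EuclideanSpace ℝ (Fin 3)) ∈ Z)
    (hroot : ∀ Z ∈ 𝒞, ∀ z ∈ Z, (fun p => p - z) '' Z ∈ 𝒞)
    (hclosed : ∀ Zs : ℕ → Set (EuclideanSpace ℝ (Fin 3)), (∀ k, Zs k ∈ 𝒞) →
      ∀ Z : Set (EuclideanSpace ℝ (Fin 3)), (0 : EuclideanSpace ℝ (Fin 3)) ∈ Z →
        (∀ p ∈ Z, ∀ q ∈ Z, p ≠ q → δ ≤ dist p q) →
        (∀ R ε : ℝ, 0 < ε → ∀ᶠ k in Filter.atTop, Match ε R 0 (Zs k) Z) → Z ∈ 𝒞) :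
    ∃ Z ∈ 𝒞, ∀ R ε : ℝ, 0 < ε → ∃ G : ℝ, ∀ w ∈ Z, ∃ g ∈ Z, dist g w ≤ G ∧
      Match ε R 0 ((fun p => p - g) '' Z) Z := by
  classical
  -- conditions: a dense sequence and an enumeration of `ℕ × ℕ × Finset ℕ`
  obtain ⟨u, hu⟩ := TopologicalSpace.exists_dense_seq (EuclideanSpace ℝ (Fin 3))
  obtain ⟨e, he⟩ := exists_surjective_nat (ℕ × ℕ × Finset ℕ)
  set cond : ℕ → ℝ × ℝ × Set (EuclideanSpace ℝ (Fin 3)) :=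
    fun n => (((e n).1 : ℝ), 1 / (((e n).2.1 : ℝ) + 1), u '' ((e n).2.2 : Set ℕ)) with hcond_def
  have hcond : ∀ n, 0 ≤ (cond n).1 := fun n => Nat.cast_nonneg _
  -- the descent and the diagonal limit `Zinf`, which lies in every stage
  obtain ⟨fam, hfsub, hfne, hfroot, hflim, hanti, hkey⟩ :=
    mrDescend (δ := δ) hne hroot hclosed cond hcond
  choose Zn hZn using hfne
  obtain ⟨φ, Zinf, hφ, hZinf𝒞, h0inf, hsepinf, hconv⟩ :=
    mrCompact hδ hsep h0 hclosed (Zs := Zn) fun n => hfsub n (hZn n)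
  have hmem : ∀ n, Zinf ∈ fam n := by
    intro n
    refine hflim n (fun k => Zn (φ (k + n))) (fun k => ?_) Zinf h0inf hsepinf fun R ε hε =>
      (tendsto_add_atTop_nat n).eventually (hconv R ε hε)
    exact hanti ((Nat.le_add_left n k).trans hφ.le_apply) (hZn (φ (k + n)))
  refine ⟨Zinf, hZinf𝒞, ?_⟩
  -- reduction to natural radius `N` and tolerance `2 / (m + 1)`
  suffices key : ∀ N m : ℕ, ∃ G : ℝ, ∀ w ∈ Zinf, ∃ g ∈ Zinf, dist g w ≤ G ∧
      Match (2 * (1 / ((m : ℝ) + 1))) N 0 ((fun p => p - g) '' Zinf) Zinf by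
    intro R ε hε
    obtain ⟨N, hN⟩ := exists_nat_ge R
    obtain ⟨m, hm⟩ := exists_nat_one_div_lt (half_pos hε)
    obtain ⟨G, hG'⟩ := key N m
    refine ⟨G, fun w hw => ?_⟩
    obtain ⟨g, hg, hgw, hbm⟩ := hG' w hw
    exact ⟨g, hg, hgw, hbm.mono (by linarith) hN⟩
  intro N m
  by_contra hcon
  push Not at hcon
  choose w hw hbad using fun k : ℕ => hcon k
  set ε₀ : ℝ := 1 / ((m : ℝ) + 1) with hε₀
  have hε₀0 : 0 < ε₀ := by positivity
  have hε₀1 : ε₀ ≤ 1 :=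
    (div_le_one (by positivity)).2 (by linarith [(Nat.cast_nonneg m : (0 : ℝ) ≤ m)])
  -- the condition "looks like `Zinf` about `0`": a finite pattern for `Zinf` on `B(0, N + 3)`
  obtain ⟨F, hF⟩ := mrPattern hu hδ hsepinf (half_pos hε₀0) ((N : ℝ) + 3)
  have hRealZ : ∃ z ∈ Zinf, ∃ ε' R₁ : ℝ, 0 ≤ ε' ∧ ε' < ε₀ ∧ (N : ℝ) + 2 < R₁ ∧
      Match ε' R₁ 0 ((fun p => p - z) '' Zinf) (u '' (F : Set ℕ)) :=
    ⟨0, h0inf, ε₀ / 2, (N : ℝ) + 3, by positivity, by linarith, by linarith, by simpa using hF⟩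
  obtain ⟨n₀, hn₀⟩ := he (N + 2, m, F)
  have hc : cond n₀ = ((N : ℝ) + 2, ε₀, u '' (F : Set ℕ)) := by
    simp [hcond_def, hn₀, hε₀]
  -- re-root `Zinf` at the bad points and extract a limit `Winf`, in every stage
  have hWmem : ∀ k n, (fun p => p - w k) '' Zinf ∈ fam n :=
    fun k n => hfroot n _ (hmem n) _ (hw k)
  obtain ⟨ψ, Winf, hψ, -, h0W, hsepW, hconvW⟩ :=
    mrCompact hδ hsep h0 hclosed (Zs := fun k => (fun p => p - w k) '' Zinf)
      fun k => hfsub 0 (hWmem k 0)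
  have hWinf : ∀ n, Winf ∈ fam n := fun n =>
    hflim n (fun k => (fun p => p - w (ψ k)) '' Zinf) (fun k => hWmem (ψ k) n) Winf h0W hsepW
      hconvW
  -- KEY: `Winf` realises the condition, since `Zinf` does and both lie in stage `n₀ + 1`
  have hk := hkey n₀
  rw [hc] at hk
  obtain ⟨wl, hwl, ε', R₁, hε'0, hε', hR₁, hbmW⟩ :=
    hk Zinf (hmem (n₀ + 1)) hRealZ Winf (hWinf (n₀ + 1))
  -- openness along the re-rooted sequence, with a root of norm `≤ ‖wl‖ + 1`
  have hev1 := mrReal_eventually hconvW hwl hε'0 hε' (by positivity) hR₁ hbmW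
  have hev2 : ∀ᶠ k in atTop, ‖wl‖ + 1 ≤ (ψ k : ℝ) :=
    (tendsto_natCast_atTop_atTop.comp hψ.tendsto_atTop).eventually (eventually_ge_atTop _)
  obtain ⟨k, ⟨z', hz', hz'n, ε'', R₂, hε''0, hε'', hR₂, hbm2⟩, hk⟩ := (hev1.and hev2).exists
  rw [mrImage_sub_sub] at hbm2
  have hg : w (ψ k) + z' ∈ Zinf := mrMem_of_mem_image hz'
  -- compose with the pattern match: a good return near the bad point `w (ψ k)`
  have hbm3 : Match (ε'' + ε₀ / 2) N 0 ((fun p => p - (w (ψ k) + z')) '' Zinf) Zinf :=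
    mrComp hbm2 hF.symm hε''0 (by positivity) (by linarith) (by linarith)
  refine hbad (ψ k) _ hg ?_ (hbm3.mono (by linarith) le_rfl)
  rw [dist_eq_norm, add_sub_cancel_left]
  linarith

end Summit.AtomisticToContinuum.Crystallization.Theorems.OverbindingBudgetHullEngine

end
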